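import Literature.AlgebraicGeometry.Frobenioids.Thm49Sub
import Literature.AlgebraicGeometry.Frobenioids.BirationalizationBiratData
import Literature.AlgebraicGeometry.Frobenioids.DivisorMonoidCategoryTheoreticity
import HarnessLib

/-!
# [FrdI] Theorem 4.9 (Category-theoreticity of Divisor Monoids): the printed proof cut into named
# sub-lemmas — statements, part II (S5 sub-DAG rows typed as NOTES in `Thm49Sub.lean`)

Mochizuki, *The geometry of Frobenioids I: the general theory*, Kyushu J. Math. **62** (2008)
293–400, §4, Theorem 4.9, statement p. 88 l. 33 – p. 89 l. 2, proof p. 89 l. 3 – p. 90 l. 54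
[cite: MochizukiFrdI2008, Thm. 4.9 p.88] (render `paper:url-bbf705efa10f`).

STATEMENTS-ONLY companion of `Thm49Sub.lean` (seat abc-iut-L1-t14), which types rows T49-L02
(`SufficesRightEqLeft`), L06 (`TwinPrimaryCriterion`), L08 (`PsiPreservesTwinPrimary`) and records rows
L01, L03, L04, L05, L07 as located notes. Per L1-lead R79 (1) (2026-08-26) those rows receive their named
`Prop`s HERE (one writer: seat abc-iut-w5-d021). This first tranche types L07 (`TwinPrimaryFromCartesianSquares`,
seat abc-iut-w5-d021) and, from the row texts of seat abc-iut-w4-d035 (verbatim,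
`staging/L1/w4-d035/Thm49RowsL03L04.snippet.lean`), L03 (`SubsetPhiPreserved` + its functoriality clause
`FunctorialOnBaseIsos`) and L04 (`FunctorialPullbacks`); rows L01/L05 (the reductions "isotropic, non-group-like
WLOG" and "perfect + strictly rational WLOG", p. 89 ll. 3–5, 38–46) are appended (append-only) once the
Thm. 4.9 assembly fixes the shape it consumes (their first holder, seat abc-iut-w4-d004, released them). Conventions: the tree's Def. 1.3 API
(`PreFrobenioid.*`), the hypothesis structure `FrdI.T42.Setting`, and — for the rows whose printed content
is Definition 4.5 (ii)/(iii) — THE birationalization datum `PreFrobenioid.biratData hF hsq`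
(`BirationalizationBiratData.lean`, seats abc-iut-L6-t6/L6-t8) with the support predicate `Supp` of
Def. 2.4 (i)(d) as a parameter constrained by the SUPPORT AXIOM "`𝔭 ∈ Supp(a)` iff some primary `a₀` of
class `𝔭` is `≼ a`" (the shape fixed for the rational-type rows by the S3 holder abc-iut-L6-t10).
Every `def … : Prop` below is a named statement, NOT asserted; closers `…_holds` are proof-only files.
Nothing of [FrdI] is strengthened; nothing here bears on [IUTchIII] Cor. 3.12.
-/

namespace Literature.AlgebraicGeometry.Frobenioids

open CategoryTheory Opposite

namespace FrdI.T49

universe w v v' u u'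

/-! ## `FrdI:Thm4.9/T49-L07` — existence of the twin-primary pair of Prop. 4.1 (iii) squares -/

/-- **T49-L07** `TwinPrimaryFromCartesianSquares`, EXISTENCE (p. 90 ll. 5–27): "since `A` is strictly
rational, it follows [cf. Definition 4.5, (ii)] that there exist, for each `𝔭 ∈ Prime(Φ_i(A))`, cartesian
commutative diagrams of pre-steps as in Proposition 4.1, (iii), [`C →γ' D`, `γ : C → B`, `δ : D → A`,
`β : B → A`] and [`C →γ' D`, `γ'' : C → A`, `δ' : D → F`, `α : A → F`] in which `α`, `β` are twin-primary
with zero divisor in `𝔭`; the pre-steps `ζ := β ∘ γ : C → A`, `γ'' : C → A` are Div-equivalent [e.g.,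
base-equivalent]. [Indeed, Definition 4.5, (ii) …, guarantees the existence of base-equivalent pre-steps
`ζ`, `γ''` — which may, moreover, be taken to be co-primary [cf. Proposition 4.1, (iii); Definition 2.4,
(i), (c), (d)], by our assumption that `C_i` is of perfect type — such that `ζ` admits a factorization
`β ∘ γ`, where `β` is primary with zero divisor that maps via `Φ(β)⁻¹` to an element of `𝔭`, and …
`𝔭` is not contained in the support of `(Φ(ζ))⁻¹(Div(γ))`.]" Rendered for ONE Frobenioid of perfect and
isotropic type with `Φ` perf-factorial (the setting after rows L01/L05), with "strictly rational" =
`PreFrobenioidData.IsStrictlyRational` (Def. 4.5 (ii)) at THE birationalization datum `biratData hF hsq`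
and a support predicate obeying the support axiom of Def. 2.4 (i)(d); the conclusion lists the seven
arrows with every property the displayed squares carry "as in Proposition 4.1, (iii)" (commutative,
cartesian among pre-steps, over CO-PRIMARY pairs `(δ, β)`, `(δ', α)` — cf. finding T49-F1 / row L08′),
`ζ = β ∘ γ` and `γ''` Div-equivalent, `α`, `β` primary steps, and "zero divisor in `𝔭`" as `Div(α) ∈ 𝔭`
(the form consumed by `TwinPrimaryCriterion`). The sentence "Conversely, given any [such] pair … it
follows immediately that `α`, `β` are twin-primary" (p. 90 ll. 28–45) is the content of row L08′
(`PsiPreservesTwinPrimary'`, seat abc-iut-w4-d105) and is not repeated here.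
[cite: MochizukiFrdI2008, Thm. 4.9 p.90] -/
def TwinPrimaryFromCartesianSquares : Prop :=
  ∀ {D : Type u} [Category.{v} D] {Φ : Dᵒᵖ ⥤ CommMonCat.{w}} {C : Type u'} [Category.{v'} C]
    (F : C ⥤ ElemFrobenioid Φ) (hF : PreFrobenioid.IsFrobenioid F) (hsq : PreFrobenioid.HasBiratSquares F),
    PreFrobenioid.IsOfPerfectType F → PreFrobenioid.IsOfIsotropicType F →
    Objectwise (fun M _ => IsPerfFactorial M) Φ →
    ∀ (Supp : ∀ {X : D}, (PreFrobenioidData.ofFunctor Φ F).Mon X →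
        Primes ((PreFrobenioidData.ofFunctor Φ F).Mon X) → Prop),
      (∀ (X : D) (a : Φ.obj (op X)) (𝔭 : Primes (Φ.obj (op X))),
          Supp a 𝔭 ↔ ∃ (a₀ : Φ.obj (op X)) (h₀ : IsPrimary a₀),
            Quotient.mk (primarySetoid _) ⟨a₀, h₀⟩ = 𝔭 ∧ Precsim a₀ a) →
      ∀ (A : C), PreFrobenioidData.IsStrictlyRational (PreFrobenioid.biratData hF hsq) Supp A →
        ∀ 𝔭 : Primes (Φ.obj (op (PreFrobenioid.baseObj F A))),
          ∃ (B C' D' F' : C) (α : A ⟶ F') (β : B ⟶ A) (γ : C' ⟶ B) (γ' : C' ⟶ D') (δ : D' ⟶ A)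
            (γ'' : C' ⟶ A) (δ' : D' ⟶ F'),
            -- `α`, `β` primary steps; all other arrows pre-steps
            PreFrobenioid.IsStep F α ∧ PreFrobenioid.IsPrimaryPreStep F α ∧
            PreFrobenioid.IsStep F β ∧ PreFrobenioid.IsPrimaryPreStep F β ∧
            PreFrobenioid.IsPreStep F γ ∧ PreFrobenioid.IsPreStep F γ' ∧ PreFrobenioid.IsPreStep F δ ∧
            PreFrobenioid.IsPreStep F γ'' ∧ PreFrobenioid.IsPreStep F δ' ∧
            -- the two commutative squares `δ ∘ γ' = β ∘ γ`, `δ' ∘ γ' = α ∘ γ''`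
            γ' ≫ δ = γ ≫ β ∧ γ' ≫ δ' = γ'' ≫ α ∧
            -- cartesian among pre-steps
            (∀ ⦃V : C⦄ (a' : V ⟶ D') (b' : V ⟶ B), PreFrobenioid.IsPreStep F a' →
                PreFrobenioid.IsPreStep F b' → a' ≫ δ = b' ≫ β → ∃! u : V ⟶ C', u ≫ γ' = a' ∧ u ≫ γ = b') ∧
            (∀ ⦃V : C⦄ (a' : V ⟶ D') (b' : V ⟶ A), PreFrobenioid.IsPreStep F a' →
                PreFrobenioid.IsPreStep F b' → a' ≫ δ' = b' ≫ α → ∃! u : V ⟶ C', u ≫ γ' = a' ∧ u ≫ γ'' = b') ∧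
            -- over CO-PRIMARY pairs `(δ, β)`, `(δ', α)` ("as in Proposition 4.1, (iii)")
            (∀ ⦃Z : C⦄ (ζ' : Z ⟶ A), PreFrobenioid.IsPreStep F ζ' →
                (∃ (ε' : D' ⟶ Z) (ι' : B ⟶ Z), PreFrobenioid.IsPreStep F ε' ∧ PreFrobenioid.IsPreStep F ι' ∧
                    ε' ≫ ζ' = δ ∧ ι' ≫ ζ' = β) → IsIso ζ') ∧
            (∀ ⦃Z : C⦄ (ζ' : Z ⟶ F'), PreFrobenioid.IsPreStep F ζ' →
                (∃ (ε' : D' ⟶ Z) (ι' : A ⟶ Z), PreFrobenioid.IsPreStep F ε' ∧ PreFrobenioid.IsPreStep F ι' ∧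
                    ε' ≫ ζ' = δ' ∧ ι' ≫ ζ' = α) → IsIso ζ') ∧
            -- `ζ := β ∘ γ` and `γ''` Div-equivalent; zero divisor of `α` in `𝔭`
            PreFrobenioid.DivEquivalent F (γ ≫ β) γ'' ∧ PreFrobenioid.Div F α ∈ 𝔭.carrier

/-! ## `FrdI:Thm4.9/T49-L03`, `T49-L04` — row texts of seat abc-iut-w4-d035 (verbatim, R79 (1) / R87 (3)) -/

/-- **T49-L03** `SubsetPhiPreserved` (p. 89 ll. 25–33): "by applying, say, the first equivalence of
categories of Definition 1.3, (iii), (d), to obtain pre-steps `φ : A → B` of `C_i` with arbitrary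
prescribed zero divisor and considering primary steps `ψ : A → C` such that `φ = ζ ∘ ψ` for some
pre-step `ζ`, one concludes immediately that this [isomorphism `Φ₁(A₁)^pf_factor ≅ Φ₂(A₂)^pf_factor`]
maps the subset `Φ₁(A₁) ⊆ Φ₁(A₁)^pf_factor` onto the subset `Φ₂(A₂) ⊆ Φ₂(A₂)^pf_factor`".
Rendered OBJECTWISE on `Φ_i(A)` (the tree assembles the prime-wise isomorphisms of Thm. 4.2 (iii)
inside `Φ₁(A)` — `IsPerfFactorial.map_mul_of_dvd_iff_of_rays`, `PerfFactorialOrderIso.lean` — rather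
than inside `Φ^pf_factor`): in a `T42.Setting`, for every object `A` the transport "pre-steps with
prescribed zero divisor" `Div φ ↦ Div(Ψ φ)` is a well-defined BIJECTION `Φ₁(A) → Φ₂(Ψ A)` compatible
with `≤`. [cite: MochizukiFrdI2008, Thm. 4.9 p.89] -/
def SubsetPhiPreserved : Prop :=
  ∀ {D₁ : Type u} [Category.{v} D₁] {Φ₁ : D₁ᵒᵖ ⥤ CommMonCat.{w}} {C₁ : Type u'} [Category.{v'} C₁]
    {D₂ : Type u} [Category.{v} D₂] {Φ₂ : D₂ᵒᵖ ⥤ CommMonCat.{w}} {C₂ : Type u'} [Category.{v'} C₂]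
    (F₁ : C₁ ⥤ ElemFrobenioid Φ₁) (F₂ : C₂ ⥤ ElemFrobenioid Φ₂) (Ψ : C₁ ≌ C₂), T42.Setting F₁ F₂ Ψ →
    ∀ A : C₁,
      ∃ f : Φ₁.obj (op (PreFrobenioid.baseObj F₁ A)) →
          Φ₂.obj (op (PreFrobenioid.baseObj F₂ (Ψ.functor.obj A))),
        Function.Bijective f ∧ (∀ x y, x ∣ y ↔ f x ∣ f y) ∧
          ∀ ⦃B : C₁⦄ (φ : A ⟶ B), PreFrobenioid.IsPreStep F₁ φ →
            f (PreFrobenioid.Div F₁ φ) = PreFrobenioid.Div F₂ (Ψ.functor.map φ)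

/-- **T49-L03, functoriality clause** `FunctorialOnBaseIsos` (p. 89 ll. 31–33): "… hence determines an
isomorphism of monoids `Φ₁(A₁) ≅ Φ₂(A₂)` which is functorial in `A₁` [regarded as an object of
`C₁^bs-iso`]". Rendered: in a `T42.Setting`, ANY family of monoid isomorphisms
`m_A : Φ₁(A) ≃* Φ₂(Ψ A)` determined by pre-steps with prescribed zero divisor
(`m_A(Div φ) = Div(Ψ φ)` for pre-steps `φ` out of `A`) is natural along every base-isomorphism
(pre-steps: Rem. 1.1.1; Frobenius type: the square of p. 80, Prop. 1.10 (i); Prop. 1.7 (ii)).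
[cite: MochizukiFrdI2008, Thm. 4.9 p.89] -/
def FunctorialOnBaseIsos : Prop :=
  ∀ {D₁ : Type u} [Category.{v} D₁] {Φ₁ : D₁ᵒᵖ ⥤ CommMonCat.{w}} {C₁ : Type u'} [Category.{v'} C₁]
    {D₂ : Type u} [Category.{v} D₂] {Φ₂ : D₂ᵒᵖ ⥤ CommMonCat.{w}} {C₂ : Type u'} [Category.{v'} C₂]
    (F₁ : C₁ ⥤ ElemFrobenioid Φ₁) (F₂ : C₂ ⥤ ElemFrobenioid Φ₂) (Ψ : C₁ ≌ C₂), T42.Setting F₁ F₂ Ψ →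
    ∀ (m : ∀ A : C₁, Φ₁.obj (op (PreFrobenioid.baseObj F₁ A)) ≃*
        Φ₂.obj (op (PreFrobenioid.baseObj F₂ (Ψ.functor.obj A)))),
      (∀ ⦃A B : C₁⦄ (φ : A ⟶ B), PreFrobenioid.IsPreStep F₁ φ →
          m A (PreFrobenioid.Div F₁ φ) = PreFrobenioid.Div F₂ (Ψ.functor.map φ)) →
      ∀ ⦃A B : C₁⦄ (φ : A ⟶ B), PreFrobenioid.IsBaseIso F₁ φ →
        ∀ x : Φ₁.obj (op (PreFrobenioid.baseObj F₁ B)),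
          m A (pull Φ₁ (PreFrobenioid.Base F₁ φ) x) =
            pull Φ₂ (PreFrobenioid.Base F₂ (Ψ.functor.map φ)) (m B x)

/-- **T49-L04** `FunctorialPullbacks` (p. 89 ll. 33–36): "Finally, the functoriality of this
isomorphism of monoids with respect to pull-back morphisms follows immediately by “pulling back
pre-steps”, as in Proposition 1.11, (v)." Rendered: in a `T42.Setting`, ANY family of maps
`m_A : Φ₁(A) → Φ₂(Ψ A)` computing `m_A(Div φ) = Div(Ψ φ)` for co-angular pre-steps `φ` out of `A`
(Def. 1.3 (iii)(d)) is natural along every pull-back morphism.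
[cite: MochizukiFrdI2008, Thm. 4.9 p.89] -/
def FunctorialPullbacks : Prop :=
  ∀ {D₁ : Type u} [Category.{v} D₁] {Φ₁ : D₁ᵒᵖ ⥤ CommMonCat.{w}} {C₁ : Type u'} [Category.{v'} C₁]
    {D₂ : Type u} [Category.{v} D₂] {Φ₂ : D₂ᵒᵖ ⥤ CommMonCat.{w}} {C₂ : Type u'} [Category.{v'} C₂]
    (F₁ : C₁ ⥤ ElemFrobenioid Φ₁) (F₂ : C₂ ⥤ ElemFrobenioid Φ₂) (Ψ : C₁ ≌ C₂), T42.Setting F₁ F₂ Ψ →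
    ∀ (m : ∀ A : C₁, Φ₁.obj (op (PreFrobenioid.baseObj F₁ A)) →
        Φ₂.obj (op (PreFrobenioid.baseObj F₂ (Ψ.functor.obj A)))),
      (∀ ⦃A B : C₁⦄ (φ : A ⟶ B), PreFrobenioid.IsCoAngularPreStep F₁ φ →
          m A (PreFrobenioid.Div F₁ φ) = PreFrobenioid.Div F₂ (Ψ.functor.map φ)) →
      ∀ ⦃A B : C₁⦄ (φ : A ⟶ B), PreFrobenioid.IsPullbackMorphism F₁ φ →
        ∀ x : Φ₁.obj (op (PreFrobenioid.baseObj F₁ B)),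
          m A (pull Φ₁ (PreFrobenioid.Base F₁ φ) x) =
            pull Φ₂ (PreFrobenioid.Base F₂ (Ψ.functor.map φ)) (m B x)

/-! ## `FrdI:Thm4.9/T49-L01`, `T49-L05` — the two WLOG reductions, typed as the transports their use requires (v2; prover: seat abc-iut-w4-d109, R91 (3)) -/

/-- **T49-L01** `IsotropicNonGroupLikeWLOG` (p. 89 ll. 3–5): "First, we observe [cf. Theorem 3.4, (i), (ii)]
that we may assume without loss of generality that `C₁`, `C₂` are of isotropic type [cf. Remark 4.5.1], but
not of group-like type [since Theorem 4.9 is vacuous if `C₁`, `C₂` are of group-like type]." Rendered as the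
TRANSPORT its use requires: an isomorphism of functors `Φ₁ ⥲ Φ₂` given on the ISOTROPIC objects only (lying
over `Ψ`, which preserves isotropic objects and isotropic hulls — Thm. 3.4 (i), the hull clause being the
input that makes `Base(Ψ h_A)` invertible; binder form agreed with the prover seat abc-iut-w4-d109, L1-lead
R97 (11)), natural along all arrows between isotropic objects, extends to an isomorphism of functors
`Ψ^Φ : Φ₁ ⥲ Φ₂` over `Ψ` on all of `C₁` (the closing shape
`PreFrobenioidData.DivisorMonoidIsoOver` of `Thm49`), for Frobenioids `C_i` (every object has an isotropic hull
`A → A^istr`, an isometric pre-step, Def. 1.3 (vii)(a); the hull's base-isomorphism transports `Φ_i(A)`). The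
"not of group-like type" clause only matters for the compatibility with `Ψ^Prime` (`Thm49_compat`) and is not
part of this transport. [cite: MochizukiFrdI2008, Thm. 4.9 p.89] -/
def IsotropicNonGroupLikeWLOG : Prop :=
  ∀ {D₁ : Type u} [Category.{v} D₁] {Φ₁ : D₁ᵒᵖ ⥤ CommMonCat.{w}} {C₁ : Type u'} [Category.{v'} C₁]
    {D₂ : Type u} [Category.{v} D₂] {Φ₂ : D₂ᵒᵖ ⥤ CommMonCat.{w}} {C₂ : Type u'} [Category.{v'} C₂]
    (F₁ : C₁ ⥤ ElemFrobenioid Φ₁) (F₂ : C₂ ⥤ ElemFrobenioid Φ₂) (Ψ : C₁ ≌ C₂),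
    PreFrobenioid.IsFrobenioid F₁ → PreFrobenioid.IsFrobenioid F₂ →
    (∀ A : C₁, PreFrobenioid.IsIsotropic F₁ A → PreFrobenioid.IsIsotropic F₂ (Ψ.functor.obj A)) →
    (∀ ⦃A B : C₁⦄ (h : A ⟶ B), PreFrobenioid.IsIsotropicHull F₁ h → PreFrobenioid.IsIsotropicHull F₂ (Ψ.functor.map h)) →
    ∀ (m : ∀ A : C₁, PreFrobenioid.IsIsotropic F₁ A →
        (Φ₁.obj (op (PreFrobenioid.baseObj F₁ A)) ≃* Φ₂.obj (op (PreFrobenioid.baseObj F₂ (Ψ.functor.obj A))))),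
      (∀ ⦃A B : C₁⦄ (hA : PreFrobenioid.IsIsotropic F₁ A) (hB : PreFrobenioid.IsIsotropic F₁ B) (φ : A ⟶ B)
          (x : Φ₁.obj (op (PreFrobenioid.baseObj F₁ B))),
          m A hA (pull Φ₁ (PreFrobenioid.Base F₁ φ) x) =
            pull Φ₂ (PreFrobenioid.Base F₂ (Ψ.functor.map φ)) (m B hB x)) →
      Nonempty (PreFrobenioidData.DivisorMonoidIsoOver (PreFrobenioidData.ofFunctor Φ₁ F₁)
        (PreFrobenioidData.ofFunctor Φ₂ F₂) Ψ)

/-- **T49-L05** `PerfectStrictlyRationalWLOG` (p. 89 ll. 38–46): "by passing to perfections [cf. Theorem 3.4,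
(iii)], we may assume without loss of generality that `C₁`, `C₂` are of perfect type [cf. also Proposition 5.5,
(iii)] … Since the right-hand and left-hand isomorphisms of Theorem 4.2, (iii), are clearly compatible with
pull-back morphisms [cf. Proposition 1.11, (v); the proof of Theorem 4.2, (iii)], and `Ψ` preserves pull-back
morphisms [cf. Theorem 3.4, (iii)], it follows that we may assume without loss of generality that `A` is
strictly rational." Perfect type being a standing field of `T42.Setting` ("after passing to the perfections";
the descent from `C^pf` to `C` is row T42-L03 `PerfectWLOG`), the content to type is the TRANSPORT ALONG A
PULL-BACK MORPHISM `ψ : A′ → A` (`A` rational ⇒ such `ψ` with `A′` strictly rational, Def. 4.5 (ii)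
`PreFrobenioidData.IsRational`). Since primes of `Φ₁(A)` need not pull back to primes of `Φ₁(A′)`, the transport
is stated for the GLOBAL (objectwise) isomorphisms of monoids (the shape rows L02/L03 assemble from the
prime-local `RightEqLeftAt`): if `m′ : Φ₁(A′) ≃ Φ₂(Ψ A′)` and `m : Φ₁(A) ≃ Φ₂(Ψ A)` both have the RIGHT-hand
property (they compute `Div(Ψ θ)` for pre-steps `θ` out of `A′`, resp. `A`) and `m′` has the LEFT-hand
property at `A′` (it computes `Φ(Ψ χ)⁻¹ Div(Ψ χ)` for co-angular pre-steps `χ` into `A′`), then `m` has the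
left-hand property at `A` (pull `χ : B → A` back along `ψ`, Prop. 1.11 (v); naturality of the right-hand maps
along `ψ`; injectivity of `Φ₂(Base(Ψ ψ_B))`, Def. 1.1 (ii)(a)). [cite: MochizukiFrdI2008, Thm. 4.9 p.89] -/
def PerfectStrictlyRationalWLOG : Prop :=
  ∀ {D₁ : Type u} [Category.{v} D₁] {Φ₁ : D₁ᵒᵖ ⥤ CommMonCat.{w}} {C₁ : Type u'} [Category.{v'} C₁]
    {D₂ : Type u} [Category.{v} D₂] {Φ₂ : D₂ᵒᵖ ⥤ CommMonCat.{w}} {C₂ : Type u'} [Category.{v'} C₂]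
    (F₁ : C₁ ⥤ ElemFrobenioid Φ₁) (F₂ : C₂ ⥤ ElemFrobenioid Φ₂) (Ψ : C₁ ≌ C₂), T42.Setting F₁ F₂ Ψ →
    ∀ {A' A : C₁} (ψ : A' ⟶ A), PreFrobenioid.IsPullbackMorphism F₁ ψ →
    ∀ (m' : Φ₁.obj (op (PreFrobenioid.baseObj F₁ A')) ≃* Φ₂.obj (op (PreFrobenioid.baseObj F₂ (Ψ.functor.obj A'))))
      (m : Φ₁.obj (op (PreFrobenioid.baseObj F₁ A)) ≃* Φ₂.obj (op (PreFrobenioid.baseObj F₂ (Ψ.functor.obj A)))),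
      -- right-hand property at `A′` and at `A` (pre-steps OUT of the object, Def. 1.3 (iii)(d) coslice)
      (∀ ⦃B' : C₁⦄ (θ : A' ⟶ B'), PreFrobenioid.IsPreStep F₁ θ →
          m' (PreFrobenioid.Div F₁ θ) = PreFrobenioid.Div F₂ (Ψ.functor.map θ)) →
      (∀ ⦃B : C₁⦄ (φ : A ⟶ B), PreFrobenioid.IsPreStep F₁ φ →
          m (PreFrobenioid.Div F₁ φ) = PreFrobenioid.Div F₂ (Ψ.functor.map φ)) →
      -- left-hand property at `A′` (co-angular pre-steps INTO the object, Def. 1.3 (iii)(d) slice)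
      (∀ ⦃B' : C₁⦄ (χ : B' ⟶ A'), PreFrobenioid.IsCoAngularPreStep F₁ χ →
          ∀ y : Φ₁.obj (op (PreFrobenioid.baseObj F₁ A')),
            pull Φ₁ (PreFrobenioid.Base F₁ χ) y = PreFrobenioid.Div F₁ χ →
              pull Φ₂ (PreFrobenioid.Base F₂ (Ψ.functor.map χ)) (m' y) =
                PreFrobenioid.Div F₂ (Ψ.functor.map χ)) →
      -- conclusion: left-hand property at `A`
      ∀ ⦃B : C₁⦄ (χ : B ⟶ A), PreFrobenioid.IsCoAngularPreStep F₁ χ →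
        ∀ y : Φ₁.obj (op (PreFrobenioid.baseObj F₁ A)),
          pull Φ₁ (PreFrobenioid.Base F₁ χ) y = PreFrobenioid.Div F₁ χ →
            pull Φ₂ (PreFrobenioid.Base F₂ (Ψ.functor.map χ)) (m y) = PreFrobenioid.Div F₂ (Ψ.functor.map χ)

end FrdI.T49

end Literature.AlgebraicGeometry.Frobenioids
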